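import Mathlib
import HarnessLib
import Summits.HubbardSuperconductivity.HubbardSuperconductivity.Theorems.KLProgrammeKLRegimeSplitTwoLegSizesMSChainTableFrames
import Summits.HubbardSuperconductivity.HubbardSuperconductivity.Theorems.KLProgrammeKLRegimeSplitTwoLegSizesMSWithPieces

/-!
# Route `KLProgramme`, crux K3 — (E3a-MS) supplier keyed by the admissible pieces with the LOW-PART TOTALS AS HYPOTHESES
# (repair MS-A34-ter (K4); k3c3-p1 g4)

Seat hubbard-kl-k3c3-p1 (g4).  In the (L)+(F) chain the base frame carries the Jackson LOW PARTS of all deep pieces; the order-3/4 sizes of the chain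
frames therefore contain the low-part totals `Λ_j = Σ_{m′ ∈ Ioc n₀ N} ‖Dʲ lowPart d (Kp m′)‖`.  The e-free order-4 transport entry of the slots forces
`Λ₄ ≲ U²16^{n₀}` (MS-A34-ter), which the tree's low-part estimates (contraction `3a_j(m′)`: `16^{N}`-graded; sup-Bernstein `24(2d+1)(1+4d)ʲa₀(m′)`:
`|U|·4^{3n₀}`) cannot certify — only a mixed Jackson–Bernstein bound `‖Dʲ J_d g‖ ≤ κ_j(d+1)^{j−1}‖∇g‖` can (`Λ₄ ≍ Gfr₁U²16^{n₀}`).  This file makes the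
supplier theorems INDEPENDENT of which low-part estimate is available: the totals enter as hypotheses

  `hΛ₃ : ∀ q, Σ_{m′ ∈ Ioc n₀ N} ‖D³ evalM (lowPart d (Kp m′)) q‖ ≤ Λ₃`,   `hΛ₄ : …D⁴… ≤ Λ₄`,

and everything else is discharged from the pieces (`pieceSize`) in the KL regime exactly as before:

* closed forms `msA3L R U n₀ k Λ₃ = Gfr₃U²4^{n₀+1}/3 + Λ₃ + 4·Gfr₃U²4^{n₀+k+1}/3`, `msA4L R U n₀ k Λ₄ = Gfr₄U²16^{n₀+1}/15 + Λ₄ + 4·Gfr₄U²16^{n₀+k+1}/15`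
  and the frame sizes of the chain (`norm_iteratedFDeriv_three/four_frameShift_msChain_le_L`; orders `≤ 2`: the uniform `msA R c U` of
  `…MSOfPieces`, `norm_iteratedFDeriv_frameShift_msChain_le_msA`);
* sizes `msPieceBaseL X σ R U n₀ Λ₃ Λ₄ := msSizeBaseO X σ (msA3L … 0 Λ₃) (msA4L … 0 Λ₄)`,
  `msPieceSlotL X σ ε R c U d n₀ Λ₃ Λ₄ m j := msSizeSlotO X σ ε (msA R c U) (msA3L … (m−n₀) Λ₃) (msA4L … (m−n₀) Λ₄) msDt (m ↦ msE d (pieceSize R U m)) n₀ m j`;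
* **`twoLegSizesMSWith_succ_of_pieces_L`**, **`twoLegSizesMSWith_zero_of_pieces_L`** — the budget-parametric slot text at these sizes, no fit
  (the top scale has no low parts: `twoLegSizesMSWith_top_of_frameOK`, `…MSWithPieces`).

Instances: `Λ_j :=` the sup-Bernstein totals recover `…MSWithPieces`; the mixed Jackson–Bernstein totals (when landed) give the satisfiable shape.
Proofs only; nothing about the model.
-/

noncomputable section

namespace Summit.HubbardSuperconductivity.HubbardSuperconductivity.Theorems.KLRegimeSplit

set_option linter.dupNamespace false -- summit = problem name (single-conjunct summit), D-0017
set_option maxSynthPendingDepth 4 -- nested operator-norm instances (symbol sizes up to order five), as in `…CompDiff`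

open Real Finset Literature.MathematicalPhysics.QuantumLattice Literature.MathematicalPhysics.QuantumLattice.FermiRG
open Literature.MathematicalPhysics.QuantumLattice.BandSectorCounting
open Summit.HubbardSuperconductivity.HubbardSuperconductivity.Theorems.KLProgrammeLegKernels
open Summit.HubbardSuperconductivity.HubbardSuperconductivity.Theorems.DispersionFlow
open Summit.HubbardSuperconductivity.HubbardSuperconductivity.Theorems.PerturbedFermiCurve

/-! ## §1 Closed forms with the low-part totals as parameters -/

/-- **Order-3 budget of chain position `k` with low-part total `Λ₃`**: coarse pieces + `Λ₃` + high parts up to slot `n₀+k`. -/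
def msA3L (R : RenConsts) (U : ℝ) (n₀ k : ℕ) (Λ₃ : ℝ) : ℝ :=
  R.Gfr 3 * U ^ 2 * ((4 : ℝ) ^ (n₀ + 1) / 3) + Λ₃ + 4 * (R.Gfr 3 * U ^ 2 * ((4 : ℝ) ^ (n₀ + k + 1) / 3))

/-- **Order-4 budget of chain position `k` with low-part total `Λ₄`**: coarse pieces + `Λ₄` + high parts up to slot `n₀+k`. -/
def msA4L (R : RenConsts) (U : ℝ) (n₀ k : ℕ) (Λ₄ : ℝ) : ℝ :=
  R.Gfr 4 * U ^ 2 * ((16 : ℝ) ^ (n₀ + 1) / 15) + Λ₄ + 4 * (R.Gfr 4 * U ^ 2 * ((16 : ℝ) ^ (n₀ + k + 1) / 15))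

section Frames

variable (d : ℕ) {Kp : ℕ → TrigPolyC4v} {n N : ℕ} (hnN : n ≤ N) {R : RenConsts} (hR : ∀ j, 0 ≤ R.Gfr j) {U : ℝ}
  (ha : ∀ m ≤ N, ∀ j ≤ 4, ∀ q : Momentum, ‖iteratedFDeriv ℝ j (evalM (Kp m)) q‖ ≤ pieceSize R U m j)

include hnN hR ha in
/-- **Order-3 size of chain frame `k' ≤ k`** (`k ≤ N − n`) with the low-part total `Λ₃`: `≤ msA3L R U n k Λ₃`. -/
theorem norm_iteratedFDeriv_three_frameShift_msChain_le_L {Λ₃ : ℝ}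
    (hΛ₃ : ∀ q : Momentum, ∑ m ∈ Ioc n N, ‖iteratedFDeriv ℝ 3 (evalM (lowPart d (Kp m))) q‖ ≤ Λ₃)
    {k : ℕ} (hk : k ≤ N - n) {k' : ℕ} (hk' : k' ≤ k) (q : Momentum) :
    ‖iteratedFDeriv ℝ 3 (frameShift (msChain d Kp n N k')) q‖ ≤ msA3L R U n k Λ₃ := by
  have h := norm_iteratedFDeriv_frameShift_msChain_le d Kp hnN k' 3 q
  have h1 : ∑ m ∈ range (n + 1), ‖iteratedFDeriv ℝ 3 (evalM (Kp m)) q‖ ≤ R.Gfr 3 * U ^ 2 * ((4 : ℝ) ^ (n + 1) / 3) :=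
    (Finset.sum_le_sum fun m hm => ha m (by have := mem_range.mp hm; omega) 3 (by norm_num) q).trans (sum_pieceSize_three_le hR U n)
  have hsub : Ioc n (n + k') ⊆ Ioc n (n + k) := fun m hm => by rw [Finset.mem_Ioc] at hm ⊢; omega
  have h3 : ∑ m ∈ Ioc n (n + k'), ‖iteratedFDeriv ℝ 3 (evalM (highPart d (Kp m))) q‖ ≤ 4 * (R.Gfr 3 * U ^ 2 * ((4 : ℝ) ^ (n + k + 1) / 3)) :=
    calc ∑ m ∈ Ioc n (n + k'), ‖iteratedFDeriv ℝ 3 (evalM (highPart d (Kp m))) q‖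
        ≤ ∑ m ∈ Ioc n (n + k'), 4 * anchorSize (pieceSize R U m) 3 :=
          Finset.sum_le_sum fun m hm =>
            (norm_iteratedFDeriv_evalM_highPart_le d (ha m (by have := Finset.mem_Ioc.mp hm; omega))).1 3 (by norm_num) q
      _ ≤ ∑ m ∈ Ioc n (n + k), 4 * anchorSize (pieceSize R U m) 3 :=
          Finset.sum_le_sum_of_subset_of_nonneg hsub fun m _ _ => by
            have : 0 ≤ anchorSize (pieceSize R U m) 3 := by
              unfold anchorSize; split_ifs <;> (have := pieceSize_nonneg hR U m 0; have := pieceSize_nonneg hR U m 3; positivity)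
            positivity
      _ ≤ _ := sum_highSize_three_le hR U n k
  have hif : (if (3 : ℕ) = 0 then |∑ m ∈ Ioc n N, (Kp m).eval 0| else 0) = 0 := if_neg (by norm_num)
  rw [hif] at h
  have h2 := hΛ₃ q
  unfold msA3L
  linarith

include hnN hR ha in
/-- **Order-4 size of chain frame `k' ≤ k`** (`k ≤ N − n`) with the low-part total `Λ₄`: `≤ msA4L R U n k Λ₄`. -/
theorem norm_iteratedFDeriv_four_frameShift_msChain_le_L {Λ₄ : ℝ}
    (hΛ₄ : ∀ q : Momentum, ∑ m ∈ Ioc n N, ‖iteratedFDeriv ℝ 4 (evalM (lowPart d (Kp m))) q‖ ≤ Λ₄)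
    {k : ℕ} (hk : k ≤ N - n) {k' : ℕ} (hk' : k' ≤ k) (q : Momentum) :
    ‖iteratedFDeriv ℝ 4 (frameShift (msChain d Kp n N k')) q‖ ≤ msA4L R U n k Λ₄ := by
  have h := norm_iteratedFDeriv_frameShift_msChain_le d Kp hnN k' 4 q
  have h1 : ∑ m ∈ range (n + 1), ‖iteratedFDeriv ℝ 4 (evalM (Kp m)) q‖ ≤ R.Gfr 4 * U ^ 2 * ((16 : ℝ) ^ (n + 1) / 15) :=
    (Finset.sum_le_sum fun m hm => ha m (by have := mem_range.mp hm; omega) 4 le_rfl q).trans (sum_pieceSize_four_le hR U n)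
  have hsub : Ioc n (n + k') ⊆ Ioc n (n + k) := fun m hm => by rw [Finset.mem_Ioc] at hm ⊢; omega
  have h3 : ∑ m ∈ Ioc n (n + k'), ‖iteratedFDeriv ℝ 4 (evalM (highPart d (Kp m))) q‖ ≤ 4 * (R.Gfr 4 * U ^ 2 * ((16 : ℝ) ^ (n + k + 1) / 15)) :=
    calc ∑ m ∈ Ioc n (n + k'), ‖iteratedFDeriv ℝ 4 (evalM (highPart d (Kp m))) q‖
        ≤ ∑ m ∈ Ioc n (n + k'), 4 * anchorSize (pieceSize R U m) 4 :=
          Finset.sum_le_sum fun m hm =>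
            (norm_iteratedFDeriv_evalM_highPart_le d (ha m (by have := Finset.mem_Ioc.mp hm; omega))).1 4 le_rfl q
      _ ≤ ∑ m ∈ Ioc n (n + k), 4 * anchorSize (pieceSize R U m) 4 :=
          Finset.sum_le_sum_of_subset_of_nonneg hsub fun m _ _ => by
            have : 0 ≤ anchorSize (pieceSize R U m) 4 := by
              unfold anchorSize; split_ifs <;> (have := pieceSize_nonneg hR U m 0; have := pieceSize_nonneg hR U m 4; positivity)
            positivity
      _ ≤ _ := sum_highSize_four_le hR U n k
  have hif : (if (4 : ℕ) = 0 then |∑ m ∈ Ioc n N, (Kp m).eval 0| else 0) = 0 := if_neg (by norm_num)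
  rw [hif] at h
  have h2 := hΛ₄ q
  unfold msA4L
  linarith

include hnN hR ha in
/-- **Orders `≤ 2`: every chain frame is within the uniform budget `msA R c U`** in the KL regime with the chain thresholds. -/
theorem norm_iteratedFDeriv_frameShift_msChain_le_msA {c : ℝ} (hc : 0 < c) (hcle : c ≤ klCurveC3 R / 16)
    (hU : 0 < U) (hUle : U ≤ klCurveU0 R / 16) {β : ℝ} (hβmin : klBetaMin ≤ β) (hβc : β ≤ Real.exp (c / U ^ 2))
    {μ : ℝ} (hμ : μ ∈ klWindowC) (hN : N = nScales β)
    {k : ℕ} (hk : k ≤ N - n) (q : Momentum) {j : ℕ} (hj : j ≤ 2) :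
    ‖iteratedFDeriv ℝ j (frameShift (msChain d Kp n N k)) q‖ ≤ msA R c U := by
  subst hN
  obtain ⟨hA, -, -, -, -, -⟩ := chain_regime_of_pieces hR hc hcle hU hUle hβmin hβc hμ ha hnN
  exact (norm_iteratedFDeriv_frameShift_msChain_le_sum d hnN ha hk (by omega) q).trans (hA j hj)

end Frames

/-! ## §2 The computed sizes with the low-part totals -/

/-- **BASE size keyed by the pieces, low-part totals `Λ₃, Λ₄`**: `msSizeBaseO X σ (msA3L R U n₀ 0 Λ₃) (msA4L R U n₀ 0 Λ₄)`. -/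
def msPieceBaseL (X : ℝ) (σ : ℕ → ℕ → ℝ) (R : RenConsts) (U : ℝ) (n₀ : ℕ) (Λ₃ Λ₄ : ℝ) : ℕ → ℝ :=
  msSizeBaseO X σ (msA3L R U n₀ 0 Λ₃) (msA4L R U n₀ 0 Λ₄)

/-- **SLOT size keyed by the pieces, low-part totals `Λ₃, Λ₄`** (slot `m`, chain position `m − n₀`). -/
def msPieceSlotL (X : ℝ) (σ ε : ℕ → ℕ → ℝ) (R : RenConsts) (c U : ℝ) (d n₀ : ℕ) (Λ₃ Λ₄ : ℝ) : ℕ → ℕ → ℝ := fun m j =>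
  msSizeSlotO X σ ε (msA R c U) (msA3L R U n₀ (m - n₀) Λ₃) (msA4L R U n₀ (m - n₀) Λ₄) msDt (fun m => msE d (pieceSize R U m)) n₀ m j

/-- `msPieceBaseL` unfolded to the literal shape of a fit hypothesis `hfit_n`. -/
theorem msPieceBaseL_eq (X : ℝ) (σ : ℕ → ℕ → ℝ) (R : RenConsts) (U : ℝ) (n₀ : ℕ) (Λ₃ Λ₄ : ℝ) (j : ℕ) :
    msPieceBaseL X σ R U n₀ Λ₃ Λ₄ j =
    (if j = 0 then σ 0 0 else 0) +
      (j.factorial : ℝ) ^ 2 * (2 * j.factorial * X * 200 ^ j) *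
        bellCumOsc (σ 0) (msD (msA3L R U n₀ 0 Λ₃) (msA4L R U n₀ 0 Λ₄)) j * (4 + max 1 (((j - 1).factorial : ℝ) / (8 / 5))) ^ j := rfl

/-- `msPieceSlotL` unfolded to the literal shape of a fit hypothesis `hfit_m`. -/
theorem msPieceSlotL_eq (X : ℝ) (σ ε : ℕ → ℕ → ℝ) (R : RenConsts) (c U : ℝ) (d n₀ : ℕ) (Λ₃ Λ₄ : ℝ) (m j : ℕ) :
    msPieceSlotL X σ ε R c U d n₀ Λ₃ Λ₄ m j =
    (if j = 0 then ε m 0 + σ (m - n₀ - 1) 1 *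
        msdD (msA R c U) (msA3L R U n₀ (m - n₀) Λ₃) (msA4L R U n₀ (m - n₀) Λ₄) msDt (msE d (pieceSize R U m)) 0 else 0) +
      (j.factorial : ℝ) ^ 2 * (2 * j.factorial * X * 200 ^ j) *
        (bellCumOsc (ε m) (msD (msA3L R U n₀ (m - n₀) Λ₃) (msA4L R U n₀ (m - n₀) Λ₄)) j +
          bellDiffCum (σ (m - n₀ - 1)) (msD (msA3L R U n₀ (m - n₀) Λ₃) (msA4L R U n₀ (m - n₀) Λ₄))
            (msdD (msA R c U) (msA3L R U n₀ (m - n₀) Λ₃) (msA4L R U n₀ (m - n₀) Λ₄) msDt (msE d (pieceSize R U m))) j) *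
        (4 + max 1 (((j - 1).factorial : ℝ) / (8 / 5))) ^ j := rfl

/-! ## §3 The supplier theorems with the low-part totals as hypotheses -/

section MS

variable {L M : ℕ} [NeZero L] [NeZero M] {R : RenConsts} {β U μ : ℝ}

/-- **(E3a-MS), parametric, AT SCALE `n+1` IN THE KL REGIME, KEYED BY THE ADMISSIBLE PIECES, low-part totals `Λ₃, Λ₄` as hypotheses** —
binders of `twoLegSizesMSWith_succ_of_pieces_graded` plus `hΛ₃`, `hΛ₄`; conclusion the slot text at `msPieceBaseL` / `msPieceSlotL`, no fit. -/
theorem twoLegSizesMSWith_succ_of_pieces_L (hR : ∀ j, 0 ≤ R.Gfr j) {c : ℝ} (hc : 0 < c) (hcle : c ≤ klCurveC3 R / 16)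
    (hU : 0 < U) (hUle : U ≤ klCurveU0 R / 16) (hβmin : klBetaMin ≤ β) (hβc : β ≤ Real.exp (c / U ^ 2)) (hμ : μ ∈ klWindowC)
    {K : TrigPolyC4v} {Kp : ℕ → TrigPolyC4v} (hK : ∀ p : Fin 2 → ℝ, K.eval p = ∑ m ∈ range (nScales β + 1), (Kp m).eval p)
    (ha : ∀ m ≤ nScales β, ∀ j ≤ 4, ∀ q : Momentum, ‖iteratedFDeriv ℝ j (evalM (Kp m)) q‖ ≤ pieceSize R U m j)
    {n : ℕ} (hn : n + 1 ≤ nScales β) (d : ℕ)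
    {Λ₃ : ℝ} (hΛ₃ : ∀ q : Momentum, ∑ m ∈ Ioc (n + 1) (nScales β), ‖iteratedFDeriv ℝ 3 (evalM (lowPart d (Kp m))) q‖ ≤ Λ₃)
    {Λ₄ : ℝ} (hΛ₄ : ∀ q : Momentum, ∑ m ∈ Ioc (n + 1) (nScales β), ‖iteratedFDeriv ℝ 4 (evalM (lowPart d (Kp m))) q‖ ≤ Λ₄)
    (hc₁ : Continuous (klLocalPart L M β U μ K (n + 1))) (hc₀ : Continuous (klLocalPart L M β U μ K n))
    {S : ℕ → TrigPolyC4v}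
    (hS : ∀ θ, klLocalPart L M β U μ K (n + 1) θ - klLocalPart L M β U μ K n θ =
      (S (nScales β - (n + 1))).eval (klFermiPoint μ K θ))
    {σ : ℕ → ℕ → ℝ} (hσnn : ∀ k l, 0 ≤ σ k l)
    (hσ0 : ∀ k ≤ nScales β - (n + 1), ∀ q : Momentum, |evalM (S k) q| ≤ σ k 0)
    (hσ : ∀ k ≤ nScales β - (n + 1), ∀ l, 1 ≤ l → l ≤ 5 → ∀ q : Momentum, ‖iteratedFDeriv ℝ l (evalM (S k)) q‖ ≤ σ k l)
    {ε : ℕ → ℕ → ℝ} (hεnn : ∀ m l, 0 ≤ ε m l)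
    (hε0 : ∀ m ∈ Ioc (n + 1) (nScales β), ∀ q : Momentum, |evalM (fsub (S (m - (n + 1))) (S (m - (n + 1) - 1))) q| ≤ ε m 0)
    (hε : ∀ m ∈ Ioc (n + 1) (nScales β), ∀ l, 1 ≤ l → l ≤ 4 → ∀ q : Momentum,
      ‖iteratedFDeriv ℝ l (evalM (fsub (S (m - (n + 1))) (S (m - (n + 1) - 1)))) q‖ ≤ ε m l)
    {X : ℝ} (hX : ∀ l ≤ 4, ∀ x : ℝ, ‖iteratedFDeriv ℝ l salmhoferCutoff x‖ ≤ X) :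
    TwoLegSizesMSWith L M β U μ K.eval (n + 1) (msPieceBaseL X σ R U (n + 1) Λ₃ Λ₄) (msPieceSlotL X σ ε R c U d (n + 1) Λ₃ Λ₄) := by
  obtain ⟨-, hA20, hd, ⟨hlo, hhi⟩, -, -⟩ := chain_regime_of_pieces hR hc hcle hU hUle hβmin hβc hμ ha (n := n + 1) hn
  have he : ∀ m ∈ Ioc (n + 1) (nScales β), ∀ j ≤ 4, ∀ q : Momentum,
      ‖iteratedFDeriv ℝ j (evalM (highPart d (Kp m))) q‖ ≤ msE d (pieceSize R U m) j :=
    fun m hm j hj q => norm_iteratedFDeriv_evalM_highPart_le_msE d (ha m (Finset.mem_Ioc.mp hm).2) hj q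
  have hA : ∀ k ≤ nScales β - (n + 1), ∀ p : Momentum, ∀ j ≤ 2,
      ‖iteratedFDeriv ℝ j (frameShift (msChain d Kp (n + 1) (nScales β) k)) p‖ ≤ msA R c U :=
    fun k hk p j hj => norm_iteratedFDeriv_frameShift_msChain_le_msA d hn hR ha hc hcle hU hUle hβmin hβc hμ rfl hk p hj
  exact twoLegSizesMSWith_succ_of_chainF_table_frames hμ hK hn d hc₁ hc₀ hS hA hA20 hd hlo hhi
    (fun k hk k' hk' p => norm_iteratedFDeriv_three_frameShift_msChain_le_L d hn hR ha hΛ₃ hk hk' p)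
    (fun k hk k' hk' p => norm_iteratedFDeriv_four_frameShift_msChain_le_L d hn hR ha hΛ₄ hk hk' p)
    hσnn hσ0 hσ hεnn hε0 hε he hX

/-- **(E3a-MS), parametric, AT SCALE `0` IN THE KL REGIME, KEYED BY THE ADMISSIBLE PIECES, low-part totals `Λ₃, Λ₄` as hypotheses.** -/
theorem twoLegSizesMSWith_zero_of_pieces_L (hR : ∀ j, 0 ≤ R.Gfr j) {c : ℝ} (hc : 0 < c) (hcle : c ≤ klCurveC3 R / 16)
    (hU : 0 < U) (hUle : U ≤ klCurveU0 R / 16) (hβmin : klBetaMin ≤ β) (hβc : β ≤ Real.exp (c / U ^ 2)) (hμ : μ ∈ klWindowC)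
    {K : TrigPolyC4v} {Kp : ℕ → TrigPolyC4v} (hK : ∀ p : Fin 2 → ℝ, K.eval p = ∑ m ∈ range (nScales β + 1), (Kp m).eval p)
    (ha : ∀ m ≤ nScales β, ∀ j ≤ 4, ∀ q : Momentum, ‖iteratedFDeriv ℝ j (evalM (Kp m)) q‖ ≤ pieceSize R U m j)
    (d : ℕ)
    {Λ₃ : ℝ} (hΛ₃ : ∀ q : Momentum, ∑ m ∈ Ioc 0 (nScales β), ‖iteratedFDeriv ℝ 3 (evalM (lowPart d (Kp m))) q‖ ≤ Λ₃)
    {Λ₄ : ℝ} (hΛ₄ : ∀ q : Momentum, ∑ m ∈ Ioc 0 (nScales β), ‖iteratedFDeriv ℝ 4 (evalM (lowPart d (Kp m))) q‖ ≤ Λ₄)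
    (hc₀ : Continuous (klLocalPart L M β U μ K 0))
    {S : ℕ → TrigPolyC4v}
    (hS : ∀ θ, klLocalPart L M β U μ K 0 θ - K.eval (klFermiPoint μ K θ) = (S (nScales β)).eval (klFermiPoint μ K θ))
    {σ : ℕ → ℕ → ℝ} (hσnn : ∀ k l, 0 ≤ σ k l)
    (hσ0 : ∀ k ≤ nScales β, ∀ q : Momentum, |evalM (S k) q| ≤ σ k 0)
    (hσ : ∀ k ≤ nScales β, ∀ l, 1 ≤ l → l ≤ 5 → ∀ q : Momentum, ‖iteratedFDeriv ℝ l (evalM (S k)) q‖ ≤ σ k l)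
    {ε : ℕ → ℕ → ℝ} (hεnn : ∀ m l, 0 ≤ ε m l)
    (hε0 : ∀ m ∈ Ioc 0 (nScales β), ∀ q : Momentum, |evalM (fsub (S m) (S (m - 1))) q| ≤ ε m 0)
    (hε : ∀ m ∈ Ioc 0 (nScales β), ∀ l, 1 ≤ l → l ≤ 4 → ∀ q : Momentum,
      ‖iteratedFDeriv ℝ l (evalM (fsub (S m) (S (m - 1)))) q‖ ≤ ε m l)
    {X : ℝ} (hX : ∀ l ≤ 4, ∀ x : ℝ, ‖iteratedFDeriv ℝ l salmhoferCutoff x‖ ≤ X) :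
    TwoLegSizesMSWith L M β U μ K.eval 0 (msPieceBaseL X σ R U 0 Λ₃ Λ₄) (msPieceSlotL X σ ε R c U d 0 Λ₃ Λ₄) := by
  have hn : 0 ≤ nScales β := Nat.zero_le _
  obtain ⟨-, hA20, hd, ⟨hlo, hhi⟩, -, -⟩ := chain_regime_of_pieces hR hc hcle hU hUle hβmin hβc hμ ha hn
  have he : ∀ m ∈ Ioc 0 (nScales β), ∀ j ≤ 4, ∀ q : Momentum,
      ‖iteratedFDeriv ℝ j (evalM (highPart d (Kp m))) q‖ ≤ msE d (pieceSize R U m) j :=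
    fun m hm j hj q => norm_iteratedFDeriv_evalM_highPart_le_msE d (ha m (Finset.mem_Ioc.mp hm).2) hj q
  have hA : ∀ k ≤ nScales β - 0, ∀ p : Momentum, ∀ j ≤ 2,
      ‖iteratedFDeriv ℝ j (frameShift (msChain d Kp 0 (nScales β) k)) p‖ ≤ msA R c U :=
    fun k hk p j hj => norm_iteratedFDeriv_frameShift_msChain_le_msA d hn hR ha hc hcle hU hUle hβmin hβc hμ rfl hk p hj
  exact twoLegSizesMSWith_zero_of_chainF_table_frames hμ hK d hc₀ hS hA hA20 hd hlo hhi
    (fun k hk k' hk' p => norm_iteratedFDeriv_three_frameShift_msChain_le_L d hn hR ha hΛ₃ hk hk' p)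
    (fun k hk k' hk' p => norm_iteratedFDeriv_four_frameShift_msChain_le_L d hn hR ha hΛ₄ hk hk' p)
    hσnn hσ0 hσ hεnn hε0 hε he hX

end MS

end Summit.HubbardSuperconductivity.HubbardSuperconductivity.Theorems.KLRegimeSplit

end
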